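import Mathlib
import Literature.NumberTheory.Transcendental.KZCubePolynomialKernel
import Summits.KontsevichZagierPeriods.KontsevichZagierPeriods.Theorems.InverseLandauTateFamilyKernelStubBoundaryFamily
import Summits.KontsevichZagierPeriods.KontsevichZagierPeriods.Theorems.InverseLandauTateFamilyKernelStubProductIntegral

/-!
# Crux `TateFamilyKernel` (stmt-KontsevichZagierPeriods-9130), line `Sketch` — stub `stub_indepClass`

The research stub `stub_descentLocal` (local descent normal form at the fibre, dimension `N + 2`)
of the lead's skeleton of the crux
`Summit.KontsevichZagierPeriods.KontsevichZagierPeriods.Theses.InverseLandau.TateFamilyKernel`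
on a CLASS: denominators independent of the first cube variable, `Q = rename Fin.succ Q̃`.

For such `Q` and any numerator `P`, choose a polynomial antiderivative `∂₀ A = P`
(`KZ.exists_pderiv_eq`) and put `P̃ := A|_{w₀=1} − A|_{w₀=0}` (face substitutions
`aeval_snoc_faceSubst`, a polynomial in the remaining `N + 1` cube variables and the parameter).
Since `∂₀ Q = 0`,

  `P/Q = [∂₀(A/Q) − (A/Q)|_{w₀=1} + (A/Q)|_{w₀=0}] + P̃/Q̃`

pointwise on the closed cube at the fibre `ϖ₀` — ONE Ayoub element (`m = 0` auxiliary variables)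
plus ONE product term with cofactor `1`, the lower family `P̃/Q̃` being placed on the coordinates
`1, …, N + 1` by the rotation `finRotate (N + 2)`.  The lower family is a LOCAL vanishing family of
dimension `N + 1` on the same parameter interval `(a, b)`: `Q̃ ≠ 0` on `[0,1]^{N+1} × (a,b)` (a face
of the cube lies in the cube) and `∫_{□^{N+1}} P̃/Q̃ (·, ϖ) = ∫_{□^{N+2}} P/Q (·, ϖ) = 0`
(Newton–Leibniz along the coordinate `0`, `setIntegral_cube_partialDeriv`, with the quotient-rule
derivative `hasDerivAt_slice_update`; open cube = closed cube up to null faces).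

No named fact, no new definition.
-/

noncomputable section
open MeasureTheory Set MvPolynomial
open Literature.NumberTheory.Transcendental
open Literature.ModelTheory.ExponentialFields (IsSemialgebraic)
namespace Summit.KontsevichZagierPeriods.InverseLandau.TateFamilyKernel.Descent

/-- A polynomial renamed along `Fin.succ` does not involve the variable `0`, so its partial
derivative along `0` vanishes. [folklore] -/
theorem pderiv_zero_rename_succ (N : ℕ) (Qt : MvPolynomial (Fin (N + 1 + 1)) ℚ) :
    pderiv 0 (rename Fin.succ Qt : MvPolynomial (Fin (N + 2 + 1)) ℚ) = 0 :=
  pderiv_eq_zero_of_notMem_vars fun h => by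
    obtain ⟨i, _, hi⟩ := mem_vars_rename _ _ h
    exact Fin.succ_ne_zero _ hi

/-- Evaluating `rename Fin.succ Q̃` at the point `(z, ϖ)` (parameter last) is evaluating `Q̃` at
`(Fin.tail z, ϖ)`: the renamed polynomial reads the cube coordinates `1, …, N + 1`. [folklore] -/
theorem aeval_snoc_rename_succ (N : ℕ) (Qt : MvPolynomial (Fin (N + 1 + 1)) ℚ)
    (z : Fin (N + 2) → ℝ) (ϖ : ℝ) :
    aeval (Fin.snoc z ϖ : Fin (N + 2 + 1) → ℝ) (rename Fin.succ Qt) =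
      aeval (Fin.snoc (Fin.tail z) ϖ : Fin (N + 1 + 1) → ℝ) Qt := by
  have h : (Fin.snoc z ϖ : Fin (N + 2 + 1) → ℝ) ∘ Fin.succ = (Fin.snoc (Fin.tail z) ϖ : Fin (N + 1 + 1) → ℝ) := by
    funext s
    refine Fin.lastCases ?_ (fun t => ?_) s
    · simp only [Function.comp_apply, Fin.succ_last, Fin.snoc_last]
    · simp only [Function.comp_apply, Fin.succ_castSucc, Fin.snoc_castSucc, Fin.tail]
  rw [aeval_rename, h]

/-- The rotation `finRotate (n + 2)` sends the first block `castAdd 1 t = castSucc t` of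
`Fin ((n + 1) + 1)` to `t.succ`. [folklore] -/
theorem finRotate_castAdd_one {n : ℕ} (t : Fin (n + 1)) :
    finRotate (n + 2) (Fin.castAdd 1 t) = t.succ := by
  change finRotate (n + 2) (Fin.castSucc t) = t.succ
  rw [finRotate_apply, Fin.coeSucc_eq_succ]

/-- A point `(c, x)` with `c ∈ [0,1]` and `x ∈ [0,1]^{N+1}` lies in `[0,1]^{N+2}`. [folklore] -/
theorem cons_mem_Icc {N : ℕ} {c : ℝ} (hc : c ∈ Icc (0 : ℝ) 1) {x : Fin (N + 1) → ℝ}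
    (hx : ∀ t, x t ∈ Icc (0 : ℝ) 1) : ∀ t, (Fin.cons c x : Fin (N + 2) → ℝ) t ∈ Icc (0 : ℝ) 1 :=
  fun t => Fin.cases (by simpa using hc) (fun s => by simpa using hx s) t

/-- **The local descent normal form on the class `Q = rename Fin.succ Q̃`** (stub `stub_indepClass`
of the crux `TateFamilyKernel`, line `Sketch`; the research stub `stub_descentLocal` on the class of
denominators independent of the cube variable `w₀`). With an antiderivative `∂₀A = P`
(`KZ.exists_pderiv_eq`) and `P̃ := A|_{w₀=1} − A|_{w₀=0}`, one has on `[0,1]^{N+2}` at the fibre `ϖ₀`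
`P/Q = relA₀(A/Q) + P̃/Q̃` (`m = 0`, one Ayoub element, one product term with cofactor `1`, the
lower family placed on the coordinates `1, …, N + 1` by `finRotate (N + 2)`), and `P̃/Q̃` is a LOCAL
vanishing family of dimension `N + 1` on `(a, b)` (Fubini/Newton–Leibniz along `w₀`:
`∫_{□^{N+1}} P̃/Q̃ = ∫_{□^{N+2}} P/Q = 0`). [cite: KontsevichZagier2001, §1.2] [cite: Ayoub2014, Def. 10] -/
theorem stub_indepClass (N : ℕ) (P : MvPolynomial (Fin (N + 2 + 1)) ℚ) (Qt : MvPolynomial (Fin (N + 1 + 1)) ℚ)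
    (a b : ℝ)
    (hadm : ∀ (z : Fin (N + 2) → ℝ) (ϖ : ℝ), (∀ t, z t ∈ Icc (0 : ℝ) 1) → ϖ ∈ Ioo a b →
      aeval (Fin.snoc z ϖ : Fin (N + 2 + 1) → ℝ) (rename Fin.succ Qt) ≠ 0)
    (hvan : ∀ ϖ ∈ Ioo a b, ∫ z in Set.pi Set.univ (fun _ : Fin (N + 2) => Ioo (0 : ℝ) 1),
      aeval (Fin.snoc z ϖ : Fin (N + 2 + 1) → ℝ) P /
        aeval (Fin.snoc z ϖ : Fin (N + 2 + 1) → ℝ) (rename Fin.succ Qt) = 0)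
    (ϖ₀ : ℝ) (halg : IsAlgebraic ℚ ϖ₀) (hϖ₀ : ϖ₀ ∈ Ioo a b) :
      ∃ (m K : ℕ) (A Dn : Fin K → MvPolynomial (Fin (N + 2 + m + 1)) ℚ) (i : Fin K → Fin (N + 2 + m))
        (L : ℕ) (B E : Fin L → MvPolynomial (Fin (N + 2 + m + 1)) ℚ)
        (σ : Fin L → Equiv.Perm (Fin (N + 2 + m))) (S : Fin L → Finset (Fin (N + 2 + m)))
        (J : ℕ) (d c : Fin J → ℕ) (e : ∀ j, Fin (d j + c j) ≃ Fin (N + 2 + m))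
        (Pj Qj : ∀ j, MvPolynomial (Fin (d j + 1)) ℚ) (aj bj : Fin J → ℝ)
        (Bj Ej : ∀ j, MvPolynomial (Fin (c j + 1)) ℚ),
        (∀ k, ∀ w ∈ KZ.cube (N + 2 + m), aeval (Fin.snoc w ϖ₀ : Fin (N + 2 + m + 1) → ℝ) (Dn k) ≠ 0) ∧
        (∀ l, ∀ w ∈ KZ.cube (N + 2 + m), aeval (Fin.snoc w ϖ₀ : Fin (N + 2 + m + 1) → ℝ) (E l) ≠ 0) ∧
        (∀ j, d j ≤ N + 1) ∧
        (∀ j (z : Fin (d j) → ℝ) (ϖ : ℝ), (∀ t, z t ∈ Icc (0 : ℝ) 1) → ϖ ∈ Ioo (aj j) (bj j) →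
          aeval (Fin.snoc z ϖ : Fin (d j + 1) → ℝ) (Qj j) ≠ 0) ∧
        (∀ j, ∀ ϖ ∈ Ioo (aj j) (bj j), ∫ z in Set.pi Set.univ (fun _ : Fin (d j) => Ioo (0 : ℝ) 1),
          aeval (Fin.snoc z ϖ : Fin (d j + 1) → ℝ) (Pj j) / aeval (Fin.snoc z ϖ : Fin (d j + 1) → ℝ) (Qj j) = 0) ∧
        (∀ j, ϖ₀ ∈ Ioo (aj j) (bj j)) ∧
        (∀ j, ∀ y ∈ KZ.cube (c j), aeval (Fin.snoc y ϖ₀ : Fin (c j + 1) → ℝ) (Ej j) ≠ 0) ∧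
        (∀ w ∈ KZ.cube (N + 2 + m),
          aeval (Fin.snoc (fun t => w (Fin.castAdd m t)) ϖ₀ : Fin (N + 2 + 1) → ℝ) P /
              aeval (Fin.snoc (fun t => w (Fin.castAdd m t)) ϖ₀ : Fin (N + 2 + 1) → ℝ) (rename Fin.succ Qt) =
            (∑ k : Fin K,
              (aeval (Fin.snoc w ϖ₀ : Fin (N + 2 + m + 1) → ℝ)
                  (pderiv (Fin.castSucc (i k)) (A k) * Dn k - A k * pderiv (Fin.castSucc (i k)) (Dn k)) /
                aeval (Fin.snoc w ϖ₀ : Fin (N + 2 + m + 1) → ℝ) (Dn k ^ 2)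
              - aeval (Fin.snoc (Function.update w (i k) 1) ϖ₀ : Fin (N + 2 + m + 1) → ℝ) (A k) /
                  aeval (Fin.snoc (Function.update w (i k) 1) ϖ₀ : Fin (N + 2 + m + 1) → ℝ) (Dn k)
              + aeval (Fin.snoc (Function.update w (i k) 0) ϖ₀ : Fin (N + 2 + m + 1) → ℝ) (A k) /
                  aeval (Fin.snoc (Function.update w (i k) 0) ϖ₀ : Fin (N + 2 + m + 1) → ℝ) (Dn k))) +
            (∑ l : Fin L,
              (aeval (Fin.snoc w ϖ₀ : Fin (N + 2 + m + 1) → ℝ) (B l) /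
                  aeval (Fin.snoc w ϖ₀ : Fin (N + 2 + m + 1) → ℝ) (E l) -
                aeval (Fin.snoc (fun t => if t ∈ S l then 1 - w (σ l t) else w (σ l t)) ϖ₀ :
                    Fin (N + 2 + m + 1) → ℝ) (B l) /
                  aeval (Fin.snoc (fun t => if t ∈ S l then 1 - w (σ l t) else w (σ l t)) ϖ₀ :
                    Fin (N + 2 + m + 1) → ℝ) (E l))) +
            (∑ j : Fin J,
              aeval (Fin.snoc (fun t => w (e j (Fin.castAdd (c j) t))) ϖ₀ : Fin (d j + 1) → ℝ) (Pj j) /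
                  aeval (Fin.snoc (fun t => w (e j (Fin.castAdd (c j) t))) ϖ₀ : Fin (d j + 1) → ℝ) (Qj j) *
                (aeval (Fin.snoc (fun t => w (e j (Fin.natAdd (d j) t))) ϖ₀ : Fin (c j + 1) → ℝ) (Bj j) /
                  aeval (Fin.snoc (fun t => w (e j (Fin.natAdd (d j) t))) ϖ₀ : Fin (c j + 1) → ℝ) (Ej j))))  := by
  have _ := halg
  have h0I : (0 : ℝ) ∈ Icc (0 : ℝ) 1 := ⟨le_rfl, zero_le_one⟩
  have h1I : (1 : ℝ) ∈ Icc (0 : ℝ) 1 := ⟨zero_le_one, le_rfl⟩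
  /- Step 0: the antiderivative `∂₀ G = P` and `∂₀ Q = 0`. -/
  obtain ⟨G, hG⟩ := KZ.exists_pderiv_eq (0 : Fin (N + 2 + 1)) P
  have hpdQ : pderiv 0 (rename Fin.succ Qt : MvPolynomial (Fin (N + 2 + 1)) ℚ) = 0 :=
    pderiv_zero_rename_succ N Qt
  have hnum : pderiv (Fin.castSucc (0 : Fin (N + 2))) G * (rename Fin.succ Qt : MvPolynomial (Fin (N + 2 + 1)) ℚ) -
      G * pderiv (Fin.castSucc (0 : Fin (N + 2))) (rename Fin.succ Qt : MvPolynomial (Fin (N + 2 + 1)) ℚ) =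
      P * (rename Fin.succ Qt : MvPolynomial (Fin (N + 2 + 1)) ℚ) := by
    rw [Fin.castSucc_zero, hG, hpdQ, mul_zero, sub_zero]
  /- Step 1: evaluation of `Q` and of the face substitutions. -/
  have hQev : ∀ (z : Fin (N + 2) → ℝ) (ϖ : ℝ),
      aeval (Fin.snoc z ϖ : Fin (N + 2 + 1) → ℝ) (rename Fin.succ Qt) =
        aeval (Fin.snoc (Fin.tail z) ϖ : Fin (N + 1 + 1) → ℝ) Qt :=
    aeval_snoc_rename_succ N Qt
  obtain ⟨Pt, hPt⟩ : ∃ Pt : MvPolynomial (Fin (N + 1 + 1)) ℚ, Pt =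
      aeval (Fin.snoc (Fin.insertNth 0 (C 1) (fun t : Fin (N + 1) => X (Fin.castSucc t)))
          (X (Fin.last (N + 1))) : Fin (N + 2 + 1) → MvPolynomial (Fin (N + 1 + 1)) ℚ) G -
        aeval (Fin.snoc (Fin.insertNth 0 (C 0) (fun t : Fin (N + 1) => X (Fin.castSucc t)))
          (X (Fin.last (N + 1))) : Fin (N + 2 + 1) → MvPolynomial (Fin (N + 1 + 1)) ℚ) G := ⟨_, rfl⟩
  have hPtev : ∀ (x : Fin (N + 1) → ℝ) (ϖ : ℝ), aeval (Fin.snoc x ϖ : Fin (N + 1 + 1) → ℝ) Pt =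
      aeval (Fin.snoc (Fin.cons 1 x : Fin (N + 2) → ℝ) ϖ : Fin (N + 2 + 1) → ℝ) G -
        aeval (Fin.snoc (Fin.cons 0 x : Fin (N + 2) → ℝ) ϖ : Fin (N + 2 + 1) → ℝ) G := by
    intro x ϖ
    rw [hPt, map_sub, aeval_snoc_faceSubst, aeval_snoc_faceSubst, Fin.insertNth_zero',
      Fin.insertNth_zero', Rat.cast_one, Rat.cast_zero]
  /- Step 2: admissibility of `Q` on the closed cube, and of `Q̃` (faces lie in the cube). -/
  have hQne : ∀ ϖ ∈ Ioo a b, ∀ w ∈ KZ.cube (N + 2),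
      aeval (Fin.snoc w ϖ : Fin (N + 2 + 1) → ℝ) (rename Fin.succ Qt) ≠ 0 :=
    fun ϖ hϖ w hw => hadm w ϖ (fun t => hw t) hϖ
  have hQt_ne : ∀ (x : Fin (N + 1) → ℝ) (ϖ : ℝ), (∀ t, x t ∈ Icc (0 : ℝ) 1) → ϖ ∈ Ioo a b →
      aeval (Fin.snoc x ϖ : Fin (N + 1 + 1) → ℝ) Qt ≠ 0 := by
    intro x ϖ hx hϖ
    have h := hadm (Fin.cons 0 x) ϖ (cons_mem_Icc h0I hx) hϖ
    rwa [hQev, Fin.tail_cons] at h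
  /- Step 3: the lower family has vanishing open-cube integrals (Newton–Leibniz along `w₀`). -/
  have hlowvan : ∀ ϖ ∈ Ioo a b, ∫ z in Set.pi Set.univ (fun _ : Fin (N + 1) => Ioo (0 : ℝ) 1),
      aeval (Fin.snoc z ϖ : Fin (N + 1 + 1) → ℝ) Pt / aeval (Fin.snoc z ϖ : Fin (N + 1 + 1) → ℝ) Qt = 0 := by
    intro ϖ hϖ
    have hQϖ := hQne ϖ hϖ
    obtain ⟨g, hg⟩ : ∃ g : (Fin (N + 2) → ℝ) → ℝ, g = fun w =>
        aeval (Fin.snoc w ϖ : Fin (N + 2 + 1) → ℝ) G /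
          aeval (Fin.snoc w ϖ : Fin (N + 2 + 1) → ℝ) (rename Fin.succ Qt) := ⟨_, rfl⟩
    obtain ⟨g', hg'⟩ : ∃ g' : (Fin (N + 2) → ℝ) → ℝ, g' = fun w =>
        aeval (Fin.snoc w ϖ : Fin (N + 2 + 1) → ℝ) P /
          aeval (Fin.snoc w ϖ : Fin (N + 2 + 1) → ℝ) (rename Fin.succ Qt) := ⟨_, rfl⟩
    have hga : AnalyticOnNhd ℝ g (KZ.cube (N + 2)) := by
      rw [hg]
      exact analyticOnNhd_slice G _ ϖ hQϖ
    have hg'a : AnalyticOnNhd ℝ g' (KZ.cube (N + 2)) := by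
      rw [hg']
      exact analyticOnNhd_slice P _ ϖ hQϖ
    have hder : ∀ w ∈ KZ.cube (N + 2),
        HasDerivAt (fun t : ℝ => g (Function.update w 0 t)) (g' w) (w 0) := by
      intro w hw
      rw [hg, hg']
      refine (hasDerivAt_slice_update G _ ϖ 0 w (hQϖ w hw)).congr_deriv ?_
      rw [hnum, map_mul, map_pow, sq, mul_div_mul_right _ _ (hQϖ w hw)]
    have hSt := setIntegral_cube_partialDeriv 0 hga hder hg'a.continuousOn
    have h0 : ∫ w in KZ.cube (N + 2), g' w = 0 := by
      rw [← setIntegral_pi_Ioo_eq_setIntegral_cube', hg']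
      exact hvan ϖ hϖ
    have hface : ∀ c : ℝ, c ∈ Icc (0 : ℝ) 1 →
        IntegrableOn (fun x : Fin (N + 1) → ℝ => g (Fin.insertNth 0 c x)) (KZ.cube (N + 1)) :=
      fun c hc => (analyticOnNhd_comp_insertNth hga 0 hc).continuousOn.integrableOn_compact
        KZ.isCompact_cube
    have hval : ∀ x : Fin (N + 1) → ℝ,
        aeval (Fin.snoc x ϖ : Fin (N + 1 + 1) → ℝ) Pt / aeval (Fin.snoc x ϖ : Fin (N + 1 + 1) → ℝ) Qt =
          g (Fin.insertNth 0 1 x) - g (Fin.insertNth 0 0 x) := by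
      intro x
      rw [hg, Fin.insertNth_zero', Fin.insertNth_zero']
      simp only [hQev, Fin.tail_cons, hPtev]
      rw [sub_div]
    rw [setIntegral_pi_Ioo_eq_setIntegral_cube',
      setIntegral_congr_fun KZ.measurableSet_cube (fun x _ => hval x),
      integral_sub (hface 1 h1I) (hface 0 h0I), ← hSt]
    exact h0
  /- Step 4: the pointwise identity on the closed cube at the fibre. -/
  have hident : ∀ w ∈ KZ.cube (N + 2),
      aeval (Fin.snoc (fun t : Fin (N + 2) => w (Fin.castAdd 0 t)) ϖ₀ : Fin (N + 2 + 1) → ℝ) P /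
          aeval (Fin.snoc (fun t : Fin (N + 2) => w (Fin.castAdd 0 t)) ϖ₀ : Fin (N + 2 + 1) → ℝ)
            (rename Fin.succ Qt) =
        (aeval (Fin.snoc w ϖ₀ : Fin (N + 2 + 1) → ℝ)
              (pderiv (Fin.castSucc (0 : Fin (N + 2))) G *
                  (rename Fin.succ Qt : MvPolynomial (Fin (N + 2 + 1)) ℚ) -
                G * pderiv (Fin.castSucc (0 : Fin (N + 2)))
                  (rename Fin.succ Qt : MvPolynomial (Fin (N + 2 + 1)) ℚ)) /
            aeval (Fin.snoc w ϖ₀ : Fin (N + 2 + 1) → ℝ)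
              ((rename Fin.succ Qt : MvPolynomial (Fin (N + 2 + 1)) ℚ) ^ 2)
          - aeval (Fin.snoc (Function.update w 0 1) ϖ₀ : Fin (N + 2 + 1) → ℝ) G /
              aeval (Fin.snoc (Function.update w 0 1) ϖ₀ : Fin (N + 2 + 1) → ℝ) (rename Fin.succ Qt)
          + aeval (Fin.snoc (Function.update w 0 0) ϖ₀ : Fin (N + 2 + 1) → ℝ) G /
              aeval (Fin.snoc (Function.update w 0 0) ϖ₀ : Fin (N + 2 + 1) → ℝ) (rename Fin.succ Qt)) +
        aeval (Fin.snoc (fun t : Fin (N + 1) => w (finRotate (N + 2) (Fin.castAdd 1 t))) ϖ₀ :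
              Fin (N + 1 + 1) → ℝ) Pt /
            aeval (Fin.snoc (fun t : Fin (N + 1) => w (finRotate (N + 2) (Fin.castAdd 1 t))) ϖ₀ :
              Fin (N + 1 + 1) → ℝ) Qt *
          (aeval (Fin.snoc (fun t : Fin 1 => w (finRotate (N + 2) (Fin.natAdd (N + 1) t))) ϖ₀ :
                Fin (1 + 1) → ℝ) (1 : MvPolynomial (Fin (1 + 1)) ℚ) /
            aeval (Fin.snoc (fun t : Fin 1 => w (finRotate (N + 2) (Fin.natAdd (N + 1) t))) ϖ₀ :
                Fin (1 + 1) → ℝ) (1 : MvPolynomial (Fin (1 + 1)) ℚ)) := by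
    intro w hw
    have hq : aeval (Fin.snoc (Fin.tail w) ϖ₀ : Fin (N + 1 + 1) → ℝ) Qt ≠ 0 := by
      have h := hQne ϖ₀ hϖ₀ w hw
      rwa [hQev] at h
    have hw0 : (fun t : Fin (N + 2) => w (Fin.castAdd 0 t)) = w := rfl
    have hw1 : (fun t : Fin (N + 1) => w (finRotate (N + 2) (Fin.castAdd 1 t))) = Fin.tail w :=
      funext fun t => by rw [finRotate_castAdd_one]; rfl
    have hupd : ∀ c : ℝ, Function.update w 0 c = Fin.cons c (Fin.tail w) := fun c => by
      rw [← Fin.update_cons_zero (w 0) (Fin.tail w) c, Fin.cons_self_tail]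
    rw [hw0, hw1, hupd, hupd, hnum]
    simp only [map_mul, map_pow, map_one, div_one, mul_one, hQev, Fin.tail_cons, hPtev]
    field_simp
    ring
  /- Step 5: the witnesses. -/
  refine ⟨0, 1, fun _ => G, fun _ => rename Fin.succ Qt, fun _ => (0 : Fin (N + 2)), 0,
    Fin.elim0, Fin.elim0, Fin.elim0, Fin.elim0, 1, fun _ => N + 1, fun _ => 1,
    fun _ => finRotate (N + 2), fun _ => Pt, fun _ => Qt, fun _ => a, fun _ => b, fun _ => 1, fun _ => 1,
    ?_, ?_, ?_, ?_, ?_, ?_, ?_, ?_⟩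
  · intro k w hw
    exact hQne ϖ₀ hϖ₀ w hw
  · intro l
    exact l.elim0
  · intro j
    exact le_rfl
  · intro j z ϖ hz hϖ
    exact hQt_ne z ϖ hz hϖ
  · intro j ϖ hϖ
    exact hlowvan ϖ hϖ
  · intro j
    exact hϖ₀
  · intro j y hy
    simp
  · intro w hw
    simp only [Fin.sum_univ_one, Finset.univ_eq_empty, Finset.sum_empty, add_zero]
    exact hident w hw

end Summit.KontsevichZagierPeriods.InverseLandau.TateFamilyKernel.Descent

end
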